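import Summits.ResolutionOfSingularities.ResolutionOfSingularities.Theorems.DeltaCutStellarNR
import Summits.ResolutionOfSingularities.ResolutionOfSingularities.Theorems.DeltaCutStellarLowInhabitant

/-!
# StellarCut N23f — «NonResonant»: the TIGHT `p`-DIVISIBLE MULTI-FACE `{H, 2, 2}` at `(n, p) = (4, 2)` CERTIFIED IN THE KERNEL
# — T17b's first-order safe guard FAILS there, the exact-face Hasse guard (N23a) HOLDS there (lens-6, g37 door 4; letter 222y (z1))

The new reach of the non-resonant law (N23c/N23d) over the low-residue law (R22) is the class of TIGHT star faces (weight `= n`) whose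
labels are divisible by the characteristic.  This file certifies the smallest one, `{H, D_z : 2, D_w : 2}` at marking `4` in characteristic
`2`, in all three currencies of the column:

* §1 SCHEME (T19d's model `S = 𝔽₂[x₀,x₁,x₂]_{(x)}`, `Xs = Spec S`): the datum `fT = x₀⁴ + (1 + x₂)·x₁²x₂²`, frame `tt = (0, 2, 2)`, marking
  `4`: ★ `ncHypShapeNR_tt` (non-resonant), `not_ncHypShapeLow_tt (p)` (NOT low-residue, every `p`; cn42 for the other classes), its first
  star face `{H, D 1, D 2}` has weight `0 + 2 + 2 = 4 = n` (`weightOf_tightFace`: TIGHT at round one) and ★ `not_safeFace_tightFace :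
  ¬ SafeFace 4 Xs (frame tt) {H, D 1, D 2}` — T17b's `transform_of_safe` has NO instance at this round (not heavy; `4 = 0` in the stalks;
  the label `2` at `D 1 ∋ pt` is neither `0` nor a unit) — while `exactFace_tt : ExactFace 4 Xs (frame tt) T` for EVERY face and
  ★★ `weakResolution_tt` by the NR law: a kernel trace that the law's strategy passes a tight face with even labels (z4, desirable).
* §2 POLYNOMIAL (the reduced fibre forms of that face, `κ = 𝔽₂`): on the `D_H`-chart `tightFormH = 1 + T₀²T₁² = (1 + T₀T₁)²` and on the
  `D_z`-chart `tightFormZ = T₀⁴ + T₁² = (T₀² + T₁)²` are SQUARES: every derivation kills them (`derivation_tightFormH/Z_eq_zero` — the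
  first-order unit test fails identically), and at the point `T₀ = T₁ = 1` the `D_H`-form even LIES IN `𝔪_𝔮²` (`tightFormH_mem_maximalIdeal_sq`
  — T15/T17b's first-order CONCLUSION `∉ 𝔪_𝔮²` is FALSE there, so no repair of the safe guard's hypotheses can work: the NearPoint exponent
  must be raised to `e = n = 4`); and the EXACT GUARD's conclusion holds at EVERY prime: `tightFormH_notMem_maximalIdeal_pow_four`,
  `tightFormZ_notMem_maximalIdeal_pow_four` (`∉ 𝔪_𝔮⁴`, by N23a's G1/G2 — Hasse derivatives `D⁽²⁾` see the even exponents).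
* §3 FIBRE FORM (T15's currency, ANY local ring `R` of residue characteristic `2`): for `(lH, b, a) = (0, (0,2,2), 1)` the safe hypothesis of
  T15 `fibreForm_notMem_sq'` is REFUTED (`not_safe_tightExp`) while N23a's `fibreForm_notMem_pow'` gives `∉ 𝔪_𝔮⁴` on every chart `j` at
  every admissible prime (`tightExp_fibreForm_notMem_pow_four`).

0 sorry; axioms standard. [new] [cite: Kollar2007, (3.111) Step 3] [cite: Hauser2010, §5] [cite: CossartPiltant2008, §2]
-/

noncomputable section

open CategoryTheory CategoryTheory.Limits AlgebraicGeometry TopologicalSpace IsLocalRing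
open Literature.AlgebraicGeometry.Resolution

namespace Summit.ResolutionOfSingularities.ResolutionOfSingularities.Theorems.DeltaCutClasses

open Summit.ResolutionOfSingularities.ResolutionOfSingularities.Theorems
open WeakOrderReduction ForcedTowerClasses

/-! ## §1 The scheme-level certificate: the datum `x₀⁴ + (1 + x₂)·x₁²x₂²`, frame `(V(x₀); x₁ : 2, x₂ : 2)`, marking `4` -/

namespace JetModel

/-- labels `(0, 2, 2)` on `(D 0, D 1, D 2)`: both positive labels EVEN (divisible by the characteristic `2`), residues `2 % 4 = 2 ≠ 0`. -/
def tt : Fin 3 → ℕ := ![0, 2, 2]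

/-- Label of `H = D 0` is `0`. [folklore] -/
@[simp] theorem tt_zero : tt 0 = 0 := rfl
/-- Label of `D 1` is `2`. [folklore] -/
@[simp] theorem tt_one : tt 1 = 2 := rfl
/-- Label of `D 2` is `2`. [folklore] -/
@[simp] theorem tt_two : tt 2 = 2 := rfl

/-- ★ the labels are NON-RESONANT at the marking `4` … -/
theorem tt_nonres (j : Fin 3) : tt j = 0 ∨ tt j % 4 ≠ 0 := by
  revert j; decide

/-- … and ALL divisible by the characteristic `2` (so T15/T17b's wild-coprime disjunct fails at every positive member), and the positive
ones are not low-residue at `p = 2` (`2 % 4 = 2 ≥ 2`). -/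
theorem tt_facts : (∀ j : Fin 3, 2 ∣ tt j) ∧ ¬ tt 1 % 4 < 2 ∧ ¬ 4 ∣ tt 1 := by decide

/-- `1 + x_j` is a unit of the local ring `S`. [folklore] -/
theorem isUnit_one_add_x (j : Fin 3) : IsUnit (1 + x j) := by
  have h := isUnit_one_sub_self_of_mem_nonunits (-(x j)) ((maximalIdeal S).neg_mem (x_mem j))
  rwa [sub_neg_eq_add] at h

/-- `fT = x₀⁴ + (1 + x₂)·x₁²x₂²` — the unit `1 + x₂` makes the datum a non-square (else all first derivatives would vanish and even the
support computation would need Hasse derivatives). -/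
noncomputable abbrev fT : S := x 0 ^ 4 + (1 + x 2) * (x 1 ^ 2 * x 2 ^ 2)

/-- the marked ideal `(fT~, 4)` — marking `4 = 2·2`, COMPOSITE. -/
noncomputable def MT : MarkedIdeal Xs := ⟨affineBlowup.idealSheaf (Ideal.span {fT}), [], 4⟩

/-- The ideal of the datum is `(fT)`. [folklore] -/
theorem MT_ideal : MT.ideal = affineBlowup.idealSheaf (Ideal.span {fT}) := rfl

/-- The marking of the datum is `4`. [folklore] -/
theorem MT_mult : MT.mult = 4 := rfl

/-- The frame monomial of the labels `tt` is `x₁²x₂²`. [folklore] -/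
theorem prod_tt : ∏ j, x j ^ tt j = x 1 ^ 2 * x 2 ^ 2 := by
  simp [Fin.prod_univ_three]

/-- The monomial ideal sheaf of `frame tt` is `(x₁²x₂²)`. [folklore] -/
theorem monomialIdeal_tt : monomialIdeal (frame tt) = affineBlowup.idealSheaf (Ideal.span {x 1 ^ 2 * x 2 ^ 2}) := by
  rw [monomialIdeal_frame, prod_tt]

/-- `∂fT/∂x₂ = x₁²x₂² + 2·(1 + x₂)x₁²x₂ = x₁²x₂²` in `S` (characteristic `2`). [folklore] -/
theorem exists_isDeriv_fT : ∃ δ : S → S, IsDeriv δ ∧ δ fT = x 1 ^ 2 * x 2 ^ 2 := by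
  obtain ⟨δ, hδ, he⟩ := (IsDeriv.of_derivation (MvPolynomial.pderiv (R := ZMod 2) (σ := Fin 3) 2)).exists_extend S
    (originIdeal (ZMod 2) 3).primeCompl
  refine ⟨δ, hδ, ?_⟩
  have hF : fT = algebraMap P S (MvPolynomial.X 0 ^ 4 + (1 + MvPolynomial.X 2) * (MvPolynomial.X 1 ^ 2 * MvPolynomial.X 2 ^ 2)) := by
    simp only [map_add, map_one, map_mul, map_pow]
  have h1 : MvPolynomial.pderiv (2 : Fin 3) (MvPolynomial.X 0 ^ 4 : P) = 0 := by
    rw [Derivation.leibniz_pow, MvPolynomial.pderiv_X_of_ne (show (0 : Fin 3) ≠ 2 by decide)]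
    simp only [smul_zero]
  have h2 : MvPolynomial.pderiv (2 : Fin 3) ((1 + MvPolynomial.X 2) * (MvPolynomial.X 1 ^ 2 * MvPolynomial.X 2 ^ 2) : P) =
      MvPolynomial.X 1 ^ 2 * MvPolynomial.X 2 ^ 2 + 2 * ((1 + MvPolynomial.X 2) * MvPolynomial.X 1 ^ 2 * MvPolynomial.X 2) := by
    simp only [Derivation.leibniz, Derivation.leibniz_pow, map_add, Derivation.map_one_eq_zero, MvPolynomial.pderiv_X_self,
      MvPolynomial.pderiv_X_of_ne (show (1 : Fin 3) ≠ 2 by decide), smul_eq_mul, mul_one, smul_zero, mul_zero, zero_add,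
      add_zero, nsmul_eq_mul, Nat.cast_ofNat]
    ring
  have hd : MvPolynomial.pderiv (2 : Fin 3)
      (MvPolynomial.X 0 ^ 4 + (1 + MvPolynomial.X 2) * (MvPolynomial.X 1 ^ 2 * MvPolynomial.X 2 ^ 2) : P) =
      MvPolynomial.X 1 ^ 2 * MvPolynomial.X 2 ^ 2 + 2 * ((1 + MvPolynomial.X 2) * MvPolynomial.X 1 ^ 2 * MvPolynomial.X 2) := by
    rw [map_add, h1, h2, zero_add]
  rw [hF, he, hd, map_add, map_mul (algebraMap P S) 2, map_ofNat, two_eq_zero, zero_mul, add_zero, map_mul, map_pow, map_pow]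

/-- **`Supp(fT~, 4) ⊆ V(x₀)`** — via `∂/∂x₂`: `fT ∈ 𝔪_𝔭⁴ ⊆ 𝔪_𝔭² ⇒ x₁²x₂² ∈ 𝔭 ⇒ x₀⁴ = fT − (1 + x₂)x₁²x₂² ∈ 𝔭 ⇒ x₀ ∈ 𝔭`. [folklore] -/
theorem support_MT_subset : (MT.support : Set Xs) ⊆ H.support := by
  intro p hp
  letI := stalkAlgebra p
  haveI := isLocalizationAtPrime_stalk p
  have hle : stalkIdeal MT.ideal p ≤ maximalIdeal _ ^ 4 := (MarkedIdeal.mem_support_iff MT p).mp hp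
  rw [MT_ideal, stalkIdeal_span] at hle
  have hf4 : φ p fT ∈ maximalIdeal _ ^ 4 := hle (Ideal.mem_span_singleton_self _)
  have hf2 : φ p fT ∈ maximalIdeal _ ^ 2 := Ideal.pow_le_pow_right (by norm_num) hf4
  have hf1 : fT ∈ p.asIdeal := (mem_maximalIdeal_iff p fT).mp (Ideal.pow_le_self (by norm_num) hf4)
  obtain ⟨δ, hδ, hf⟩ := exists_isDeriv_fT
  obtain ⟨δ', hδ', he⟩ := hδ.exists_extend (Xs.presheaf.stalk p) p.asIdeal.primeCompl
  have h22 : x 1 ^ 2 * x 2 ^ 2 ∈ p.asIdeal := by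
    rw [← mem_maximalIdeal_iff p, ← hf, show φ p (δ fT) = algebraMap S _ (δ fT) from rfl, ← he]
    exact hδ'.apply_mem_of_mem_sq _ hf2
  have hx0 : x 0 ^ 4 ∈ p.asIdeal := by
    have := p.asIdeal.sub_mem hf1 (p.asIdeal.mul_mem_left (1 + x 2) h22)
    rwa [add_sub_cancel_right] at this
  exact (mem_support_D 0 p).mpr (p.2.mem_of_pow_mem 4 hx0)

/-- **the unit-free NC-hyp shape (T17a) of the datum at marking `4`**: `fT = h⁴ + u·m`, `h = x₀`, `u = 1 + x₂`, `m = x₁²x₂²`. [new] -/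
theorem ncHypShapeF_tt : ncHypShapeF 4 Xs (frame tt) H MT := by
  refine ⟨rfl, fun q hq hqH => ?_, fun y _ => ?_, support_MT_subset⟩
  · obtain ⟨j, rfl⟩ := (List.mem_ofFn' _ _).mp hq
    have hj : j = 0 := D_injective hqH
    subst hj
    exact Or.inl rfl
  · refine ⟨φ y (x 0), φ y (x 1 ^ 2 * x 2 ^ 2), φ y (1 + x 2), (isUnit_one_add_x 2).map _, stalkIdeal_span _ _, ?_, ?_⟩
    · rw [monomialIdeal_tt, stalkIdeal_span]
    · rw [MT_ideal, stalkIdeal_span, ← map_pow, ← map_mul, ← map_add]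

/-- ★ **THE TIGHT DATUM IS IN THE NON-RESONANT CLASS** `ncHypShapeNR 4` (N23c) — labels `(0, 2, 2)`. [new] -/
theorem ncHypShapeNR_tt : ncHypShapeNR 4 Xs (frame tt) H MT := by
  refine ⟨ncHypShapeF_tt, by norm_num, fun K y _ => ?_⟩
  by_cases hj : ∃ j, D j = K
  · obtain ⟨j, rfl⟩ := hj
    rw [expOf_frame]
    exact tt_nonres j
  · exact Or.inl (expOf_frame_eq_zero tt fun j h => hj ⟨j, h⟩)

/-- ★ **… and NOT in R22a's LOW-RESIDUE class, at ANY `p`** (`p ∣ 4 ⇒ p = 2`; the residue `2 % 4 = 2` at `D 1 ∋ pt` is not `< 2`). [new] -/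
theorem not_ncHypShapeLow_tt (p : ℕ) : ¬ ncHypShapeLow p 4 Xs (frame tt) H MT := fun hP => by
  have hp2 : p ∣ 2 := hP.prime.dvd_of_dvd_pow (show p ∣ 2 ^ 2 by norm_num; exact hP.dvd)
  have hp : p ≤ 2 := Nat.le_of_dvd two_pos hp2
  have h := hP.labels (K := D 1) (pt_mem_support_D 1)
  rw [expOf_frame, tt_one] at h
  omega

/-- cn42: NOT in T18's coprime class at any marking (`MT.mult = 4` is not prime). [new] -/
theorem not_ncHypShapeCop_tt (q : ℕ) : ¬ ncHypShapeCop q Xs (frame tt) H MT := by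
  intro hP
  obtain rfl : 4 = q := hP.toF.mult_eq
  exact absurd hP.prime (by decide)

/-- cn42: NOT in T19's jet class at any marking. [new] -/
theorem not_ncHypShapeJet_tt (q : ℕ) : ¬ ncHypShapeJet q Xs (frame tt) H MT := by
  intro hP
  obtain rfl : 4 = q := hP.toF.mult_eq
  exact absurd hP.prime (by decide)

/-- cn42: NOT in T10's tame class (`4 = 0` in the stalks). [new] -/
theorem not_ncHypShape_tt : ¬ ncHypShape 4 Xs (frame tt) H MT := fun hP =>
  not_isUnit_zero ((four_eq_zero_stalk pt) ▸ hP.isUnit_natCast pt)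

/-- **non-degeneracy**: `pt ∈ Supp(MT)` (`x₀⁴ ∈ 𝔪⁴`, `(1 + x₂)·x₁²x₂² ∈ 𝔪⁴`): the closed point has order `4`. -/
theorem pt_mem_support_MT : pt ∈ MT.support := by
  rw [MarkedIdeal.mem_support_iff, MT_ideal, stalkIdeal_span, MT_mult, Ideal.span_le, Set.singleton_subset_iff,
    SetLike.mem_coe, maximalIdeal_stalk_eq, pt_asIdeal, ← Ideal.map_pow]
  refine Ideal.mem_map_of_mem _ (Ideal.add_mem _ (Ideal.pow_mem_pow (x_mem 0) 4) (Ideal.mul_mem_left _ _ ?_))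
  rw [show (4 : ℕ) = 2 + 2 from rfl, pow_add]
  exact Ideal.mul_mem_mul (Ideal.pow_mem_pow (x_mem 1) 2) (Ideal.pow_mem_pow (x_mem 2) 2)

/-- ★ **NON-DEGENERACY RECORD**: s.n.c. frame through `H`, the closed point in the support and on all three members, labels `2`, `2` read at
`pt`. [new] -/
theorem tt_nondegenerate :
    HasSNC (H :: boundaryOf (frame tt)) ∧ H ∈ boundaryOf (frame tt) ∧ pt ∈ MT.support ∧
      pt ∈ (D 1).support ∧ pt ∈ (D 2).support ∧ expOf (frame tt) (D 1) = 2 ∧ expOf (frame tt) (D 2) = 2 :=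
  ⟨hasSNC_frame _, H_mem_boundaryOf_frame _, pt_mem_support_MT, pt_mem_support_D 1, pt_mem_support_D 2, expOf_frame tt 1,
    expOf_frame tt 2⟩

/-- **the first star face `{H, D 1, D 2}` of the datum is TIGHT**: weight `0 + 2 + 2 = 4 =` the marking. [new] -/
theorem weightOf_tightFace [DecidableEq Xs.IdealSheafData] : weightOf (frame tt) {H, D 1, D 2} = 4 := by
  have h0 : H ∉ ({D 1, D 2} : Finset Xs.IdealSheafData) := by simp [D_injective.eq_iff]
  have h1 : D 1 ∉ ({D 2} : Finset Xs.IdealSheafData) := by simp [D_injective.eq_iff]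
  rw [weightOf_insert _ h0, weightOf_insert _ h1]
  change expOf (frame tt) (D 0) + (expOf (frame tt) (D 1) + expOf (frame tt) (D 2)) = 4
  rw [expOf_frame, expOf_frame, expOf_frame]
  rfl

/-- ★★ **T17b's SAFE GUARD FAILS AT THIS FACE** (z1): the tight face `{H, D 1, D 2}` of `(fT~, 4)` is NOT a `SafeFace` — it is not heavy
(weight `4 ≯ 4`), `4 = 2·2 = 0` is no unit in the stalks, and the label `2` of `D 1` along `V(x₁) ∋ pt` is neither `0` nor a unit (`2 = 0`).
So T17b's round lemma `ncHypShapeF.transform_of_safe` has NO instance at round one of the star strategy on this datum; the NR law passes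
this round by N23b's `transform_of_exact` (`exactFace_tt`). [new] -/
theorem not_safeFace_tightFace [DecidableEq Xs.IdealSheafData] : ¬ SafeFace 4 Xs (frame tt) {H, D 1, D 2} := by
  rintro (hlt | hunit | hlab)
  · rw [weightOf_tightFace] at hlt
    exact lt_irrefl _ hlt
  · exact not_isUnit_zero ((four_eq_zero_stalk pt) ▸ hunit pt)
  · have h := hlab (D 1) (by simp) pt (pt_mem_support_D 1)
    rw [expOf_frame, tt_one] at h
    rcases h with h | h
    · exact absurd h (by decide)
    · exact not_isUnit_zero ((two_eq_zero_stalk pt) ▸ h)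

/-- ★ **… WHILE EVERY FACE OF THE DATUM IS EXACT** (N23b `ExactFace`: heavy, or all labels `0` / non-resonant) — in particular the tight
face `{H, D 1, D 2}`, where the exact-face Hasse guard (N23a) replaces the first-order one. [new] -/
theorem exactFace_tt (T : Finset Xs.IdealSheafData) : ExactFace 4 Xs (frame tt) T :=
  ncHypShapeNR_tt.exactFace T

/-- ★★ **A WEAK RESOLUTION OF `x₀⁴ + (1 + x₂)x₁²x₂²` AT MARKING `4` IN CHARACTERISTIC `2`, by the NR list law (N23c)** — whose first
round is the tight even-labelled face certified above: the law's strategy provably passes a tight `p`-divisible multi-face. [new] -/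
theorem weakResolution_tt : ∃ s : CentreSeq Xs, WeakResolution s MT :=
  ncHypShapeNR_tt.exists_weakResolution (hasSNC_frame _) (H_mem_boundaryOf_frame _)

end JetModel

/-! ## §2 The polynomial certificate: the reduced fibre forms of the face `{H, 2, 2}` over `𝔽₂` -/

namespace TightFace

open MvPolynomial

/-- the coordinate ring of the fibre chart: `𝔽₂[T₀, T₁]`. -/
abbrev A : Type := MvPolynomial (Fin 2) (ZMod 2)

/-- the `D_H`-chart fibre form of the face `{H, D_z : 2, D_w : 2}` at marking `4`: `1 + T_z²T_w²` (`T₀ = T_z`, `T₁ = T_w`). -/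
noncomputable def tightFormH : A := 1 + X 0 ^ 2 * X 1 ^ 2

/-- the `D_z`-chart fibre form of the same face: `T_H⁴ + T_w²` (`T₀ = T_H`, `T₁ = T_w`; the exponent `b_z = 2` is divided out). -/
noncomputable def tightFormZ : A := X 0 ^ 4 + X 1 ^ 2

/-- `1 + T₀²T₁² = (1 + T₀T₁)²` in characteristic `2`. [folklore] -/
theorem tightFormH_eq_sq : tightFormH = (1 + X 0 * X 1) ^ 2 := by
  rw [tightFormH, CharTwo.add_sq, one_pow, mul_pow]

/-- `T₀⁴ + T₁² = (T₀² + T₁)²` in characteristic `2`. [folklore] -/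
theorem tightFormZ_eq_sq : tightFormZ = (X 0 ^ 2 + X 1) ^ 2 := by
  rw [tightFormZ, CharTwo.add_sq, ← pow_mul]

/-- ★ **THE FIRST-ORDER UNIT TEST FAILS IDENTICALLY on the `D_H`-chart**: every derivation (over any base) kills `1 + T₀²T₁²`. [new] -/
theorem derivation_tightFormH_eq_zero {R : Type*} [CommSemiring R] [Algebra R A] (δ : Derivation R A A) : δ tightFormH = 0 := by
  rw [tightFormH_eq_sq, Derivation.leibniz_pow, two_nsmul, CharTwo.add_self_eq_zero]

/-- ★ **… and on the `D_z`-chart**: every derivation kills `T₀⁴ + T₁²`. [new] -/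
theorem derivation_tightFormZ_eq_zero {R : Type*} [CommSemiring R] [Algebra R A] (δ : Derivation R A A) : δ tightFormZ = 0 := by
  rw [tightFormZ_eq_sq, Derivation.leibniz_pow, two_nsmul, CharTwo.add_self_eq_zero]

/-- the point `T₀ = T₁ = 1` of the fibre chart (off `V(T₀T₁)`, i.e. off the old boundary): the kernel of evaluation at `(1, 1)`. -/
noncomputable def tightPoint : Ideal A := RingHom.ker (MvPolynomial.eval ![(1 : ZMod 2), 1])

/-- `tightPoint` is a prime ideal (evaluation lands in the field `𝔽₂`). [folklore] -/
theorem tightPoint_isPrime : tightPoint.IsPrime := RingHom.ker_isPrime _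

/-- `1 + T₀T₁` vanishes at `(1, 1)` over `𝔽₂`. [folklore] -/
theorem one_add_X_mul_X_mem_tightPoint : (1 + X 0 * X 1 : A) ∈ tightPoint := by
  rw [tightPoint, RingHom.mem_ker, map_add, map_one, map_mul, MvPolynomial.eval_X, MvPolynomial.eval_X]
  decide

/-- ★★ **T15/T17b's FIRST-ORDER CONCLUSION IS FALSE AT THIS FACE**: at the point `T₀ = T₁ = 1` the `D_H`-fibre form `1 + T₀²T₁² =
(1 + T₀T₁)²` LIES IN `𝔪_𝔮²` (in any localization at that prime).  No repair of the safe guard's hypotheses helps here — the NearPoint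
exponent must be raised from `2` to `n = 4`. [new] -/
theorem tightFormH_mem_maximalIdeal_sq [tightPoint.IsPrime] (L : Type*) [CommRing L] [IsLocalRing L] [Algebra A L]
    [IsLocalization.AtPrime L tightPoint] : algebraMap A L tightFormH ∈ maximalIdeal L ^ 2 := by
  rw [← IsLocalization.AtPrime.map_eq_maximalIdeal tightPoint L, ← Ideal.map_pow]
  exact Ideal.mem_map_of_mem _ (by rw [tightFormH_eq_sq]; exact Ideal.pow_mem_pow one_add_X_mul_X_mem_tightPoint 2)

/-- the `D_H`-form as `1 + monomial`. [folklore] -/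
theorem tightFormH_eq_one_add_monomial : tightFormH = 1 + monomial (Finsupp.single 0 2 + Finsupp.single 1 2) 1 := by
  rw [tightFormH, X_pow_eq_monomial, X_pow_eq_monomial, monomial_mul, one_mul]

/-- the `D_z`-form as `T₀⁴ + monomial`. [folklore] -/
theorem tightFormZ_eq_X_pow_add_monomial : tightFormZ = X 0 ^ 4 + monomial (Finsupp.single 1 2) 1 := by
  rw [tightFormZ, X_pow_eq_monomial (n := 1)]

/-- ★★ **THE EXACT GUARD HOLDS AT THIS FACE, `D_H`-chart** (N23a G1, Hasse derivative `D_{T₀}⁽²⁾`): `1 + T₀²T₁² ∉ 𝔪_𝔮⁴` at EVERY prime `𝔮`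
of `𝔽₂[T₀, T₁]`. [new] -/
theorem tightFormH_notMem_maximalIdeal_pow_four (𝔮 : Ideal A) [𝔮.IsPrime] (L : Type*) [CommRing L] [IsLocalRing L] [Algebra A L]
    [IsLocalization.AtPrime L 𝔮] : algebraMap A L tightFormH ∉ maximalIdeal L ^ 4 := by
  rw [tightFormH_eq_one_add_monomial]
  exact algebraMap_one_add_monomial_notMem_pow _ isUnit_one (show (0 : Fin 2) ≠ 1 by decide) (by simp) (by simp)
    (by rw [map_add, Finsupp.degree_single, Finsupp.degree_single]) 𝔮 L

/-- ★★ **THE EXACT GUARD HOLDS AT THIS FACE, `D_z`-chart** (N23a G2, `D_{T₁}⁽²⁾`, degree `2 < 4`): `T₀⁴ + T₁² ∉ 𝔪_𝔮⁴` at EVERY prime. [new] -/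
theorem tightFormZ_notMem_maximalIdeal_pow_four (𝔮 : Ideal A) [𝔮.IsPrime] (L : Type*) [CommRing L] [IsLocalRing L] [Algebra A L]
    [IsLocalization.AtPrime L 𝔮] : algebraMap A L tightFormZ ∉ maximalIdeal L ^ 4 := by
  rw [tightFormZ_eq_X_pow_add_monomial]
  exact algebraMap_X_pow_add_monomial_notMem_pow_of_degree_lt 0 _ isUnit_one (show (1 : Fin 2) ≠ 0 by decide) (by simp)
    (by rw [Finsupp.degree_single]; norm_num) 𝔮 L

/-- the two conclusions side by side at the bad point: in `𝔪_𝔮²` but not in `𝔪_𝔮⁴` (so the order of `1 + T₀²T₁²` there is `2` or `3`;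
it is `2`). [new] -/
theorem tightFormH_mem_sq_and_notMem_pow_four [tightPoint.IsPrime] (L : Type*) [CommRing L] [IsLocalRing L] [Algebra A L]
    [IsLocalization.AtPrime L tightPoint] :
    algebraMap A L tightFormH ∈ maximalIdeal L ^ 2 ∧ algebraMap A L tightFormH ∉ maximalIdeal L ^ 4 :=
  ⟨tightFormH_mem_maximalIdeal_sq L, tightFormH_notMem_maximalIdeal_pow_four tightPoint L⟩

end TightFace

/-! ## §3 The fibre-form certificate (T15's currency): `(lH, b, a) = (0, (0, 2, 2), 1)` over a local ring of residue characteristic `2` -/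

section FibreCurrency

variable {R : Type*} [CommRing R] [IsLocalRing R]

/-- the exponent vector `(0, 2, 2)` of the face `{H, 2, 2}` (`H = 0`). -/
noncomputable def tightExp : Fin 3 →₀ ℕ := Finsupp.single 1 2 + Finsupp.single 2 2

/-- `tightExp` vanishes at `H = 0`. [folklore] -/
theorem tightExp_apply_zero : tightExp 0 = 0 := by
  simp [tightExp]

/-- `tightExp 1 = 2`. [folklore] -/
theorem tightExp_apply_one : tightExp 1 = 2 := by
  simp [tightExp]

/-- `|tightExp| = 4` (the face is tight at marking `4`). [folklore] -/
theorem tightExp_degree : tightExp.degree = 4 := by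
  rw [tightExp, map_add, Finsupp.degree_single, Finsupp.degree_single]

/-- every exponent is `< 4` (the face has two positive members). [folklore] -/
theorem tightExp_lt (l : Fin 3) : tightExp l < 4 := by
  fin_cases l <;> simp [tightExp]

/-- ★★ **T15's SAFE HYPOTHESIS IS REFUTED for this face over any local ring `R` with `2 ∈ 𝔪_R`** (`a = 1 ∉ 𝔪_R`, `4 = 2·2` no unit,
the exponent `2` of member `1` no unit): `fibreForm_notMem_sq'` does not apply. [new] -/
theorem not_safe_tightExp (h2 : (2 : R) ∈ maximalIdeal R) :
    ¬ ((1 : R) ∈ maximalIdeal R ∨ IsUnit ((4 : ℕ) : R) ∨ ∀ l, tightExp l = 0 ∨ IsUnit ((tightExp l : ℕ) : R)) := by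
  have h4 : ((4 : ℕ) : R) ∈ maximalIdeal R := by
    rw [show ((4 : ℕ) : R) = 2 * 2 by norm_num]
    exact Ideal.mul_mem_left _ _ h2
  rintro (h1 | hu | hl)
  · exact (maximalIdeal.isMaximal R).ne_top ((Ideal.eq_top_iff_one _).mpr h1)
  · exact mem_nonunits_iff.mp ((mem_maximalIdeal _).mp h4) hu
  · rcases hl 1 with h | h
    · rw [tightExp_apply_one] at h
      exact absurd h (by decide)
    · rw [tightExp_apply_one, Nat.cast_ofNat] at h
      exact mem_nonunits_iff.mp ((mem_maximalIdeal _).mp h2) h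

/-- ★★ **… WHILE THE EXACT GUARD (N23a `fibreForm_notMem_pow'`) DECIDES IT**: on EVERY chart `j` and at EVERY prime `𝔮` off the old
boundary, the reduced fibre form of `X_H⁴ + 1·X^{(0,2,2)}` lies outside `𝔪_𝔮⁴` — for ANY local ring `R` (no hypothesis on `2`). [new] -/
theorem tightExp_fibreForm_notMem_pow_four (j : Fin 3)
    (𝔮 : Ideal (MvPolynomial {l : Fin 3 // l ≠ j} (R ⧸ maximalIdeal R))) [𝔮.IsPrime]
    (h𝔮 : ∀ l : {l : Fin 3 // l ≠ j}, l.1 ∈ ({(0 : Fin 3)} : Set (Fin 3)) →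
      (MvPolynomial.X l : MvPolynomial {l : Fin 3 // l ≠ j} (R ⧸ maximalIdeal R)) ∉ 𝔮) :
    algebraMap _ (Localization.AtPrime 𝔮) (MvPolynomial.map (Ideal.Quotient.mk (maximalIdeal R))
      (dehomogenize j (MvPolynomial.X 0 ^ 4 + MvPolynomial.monomial tightExp (1 : R)))) ∉
      maximalIdeal (Localization.AtPrime 𝔮) ^ 4 :=
  fibreForm_notMem_pow' (by norm_num) 0 tightExp tightExp_apply_zero tightExp_degree 1 (Or.inr tightExp_lt) j 𝔮 h𝔮

end FibreCurrency

end Summit.ResolutionOfSingularities.ResolutionOfSingularities.Theorems.DeltaCutClasses
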